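import Mathlib
import Summits.Ventures.PercRepro2.CrossAPrimeTwoRoutesSupp
import Summits.Ventures.PercRepro2.CrossAPrimeAvoidCrux

/-!
# The two-route class, same-route placement, on the support and at the constant `π̃₁₂`
(blind cell PercRepro2, p5 g36; S4 §2.4 (s) addendum 41)

`CrossAPrimeTwoRoutes.crossA'so_nonneg_of_twoRoutes_same` (`o, b ∈ V₁`) with the route dictionary
required only on `supp p` and at the constant `π̃₁₂ = p₁ + p₂ − p₁p₂`:
**`crossC_nonneg_of_twoRoutes_same_supp`** — on `Q ∩ {z ∈ K}` with `z ∈ V₁` the connection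
`a₁ ↔ v` is «`π₂` open», so `xv = p₂·P(Q_{V₂}, o ∈ K)`, `yv = p₂·P(Q_{V₂}, b ∈ K)`,
`Dv = p₂·P(Q_{V₂}, o, b ∈ K)` (`prob_Dv_eq_supp_same`) and
`crossC(π̃₁₂) = p₂·PHI(V₂) + p₁(1 − p₂)·x·y ≥ 0` by `CrossAPrimeAvoidCrux.avoid_crux_nonneg`.
The route-mass bounds of `CrossAPrimeTwoRoutesSupp` apply to both marks.
Own work; standard axioms.
-/

namespace Summit.Ventures.PercRepro2

open LeafRowPendantRootSO CrossAPrimeA2Route CrossAPrimeSupport CrossAPrimeTwoRoutes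
  CrossAPrimeTwoRoutesSupp CrossAPrimeAvoidCrux

namespace CrossAPrimeTwoRoutesSameSupp

variable {V : Type*} {E : Type*} [Fintype E] [DecidableEq E] [Fintype V] [DecidableEq V]
  {R : Type*} [Field R] [LinearOrder R] [IsStrictOrderedRing R]
variable {ends : E → Sym2 V}

omit [Fintype E] [DecidableEq E] [Fintype V] [DecidableEq V] [LinearOrder R]
  [IsStrictOrderedRing R] in
/-- On the support, with both marks on `π₁`, the double route mass is the `π₂`-open part. -/
lemma route_inter2_supp_eq (p : E → R) {π₁ π₂ : Finset E} {V₁ : Finset V} {o a₁ a₂ v b : V}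
    (hconn₁ : ∀ ω ∈ allOpen π₁, ∀ x ∈ V₁, Conn ends ω a₁ x) (ho : o ∈ V₁)
    (hroute : ∀ ω ∈ supp p, ω ∈ avoidAll ends a₂ {a₁} →
      (ω ∈ connEvent ends a₁ v ↔ ω ∈ allOpen π₁ ∪ allOpen π₂)) :
    avoidAll ends a₂ {a₁} ∩ (connEvent ends a₁ v ∩ (connEvent ends a₂ o ∩ connEvent ends a₂ b)) ∩
        supp p =
      avoidAll ends a₂ {a₁} ∩ (connEvent ends a₂ o ∩ connEvent ends a₂ b) ∩ allOpen π₂ ∩ supp p := by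
  ext ω
  simp only [Set.mem_inter_iff]
  constructor
  · rintro ⟨⟨hQω, hL, hoK, hbK⟩, hs⟩
    refine ⟨⟨⟨hQω, hoK, hbK⟩, ?_⟩, hs⟩
    rcases (hroute ω hs hQω).1 hL with h | h
    · exact absurd h (not_allOpen_of_mem hconn₁ ho hQω hoK)
    · exact h
  · rintro ⟨⟨⟨hQω, hoK, hbK⟩, hπ⟩, hs⟩
    exact ⟨⟨hQω, (hroute ω hs hQω).2 (Or.inr hπ), hoK, hbK⟩, hs⟩

omit [Fintype V] [LinearOrder R] [IsStrictOrderedRing R] in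
/-- `Dv = p₂·P(Q_{V₂}, o, b ∈ K)` on the support (same-route placement). -/
lemma prob_Dv_eq_supp_same (p : E → R) {π₁ π₂ : Finset E} {V₁ V₂ : Finset V} {o a₁ a₂ v : V}
    (b : V) (hπ₂ : ∀ e ∈ π₂, ∀ x, x ∈ ends e → x = a₁ ∨ x ∈ V₂)
    (hconn₁ : ∀ ω ∈ allOpen π₁, ∀ x ∈ V₁, Conn ends ω a₁ x)
    (hconn₂ : ∀ ω ∈ allOpen π₂, ∀ x ∈ V₂, Conn ends ω a₁ x) (ho : o ∈ V₁)
    (hroute : ∀ ω ∈ supp p, ω ∈ avoidAll ends a₂ {a₁} →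
      (ω ∈ connEvent ends a₁ v ↔ ω ∈ allOpen π₁ ∪ allOpen π₂)) :
    prob p (avoidAll ends a₂ {a₁} ∩
        (connEvent ends a₁ v ∩ (connEvent ends a₂ o ∩ connEvent ends a₂ b))) =
      (∏ e ∈ π₂, p e) *
        prob p (avoidAll ends a₂ (insert a₁ V₂) ∩ (connEvent ends a₂ o ∩ connEvent ends a₂ b)) := by
  rw [prob_congr_supp p (route_inter2_supp_eq p hconn₁ ho hroute)]
  exact prob_Q_conn_conn_allOpen p hπ₂ hconn₂ a₂ o b

/-- **The same-route placement on the support, at the constant `π̃₁₂`**: `o, b ∈ V₁`. -/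
theorem crossC_nonneg_of_twoRoutes_same_supp (p : E → R) (hp : IsProbVec p)
    {π₁ π₂ : Finset E} {V₁ V₂ : Finset V} {o a₁ a₂ v b : V}
    (hπ₂ : ∀ e ∈ π₂, ∀ x, x ∈ ends e → x = a₁ ∨ x ∈ V₂)
    (hconn₁ : ∀ ω ∈ allOpen π₁, ∀ x ∈ V₁, Conn ends ω a₁ x)
    (hconn₂ : ∀ ω ∈ allOpen π₂, ∀ x ∈ V₂, Conn ends ω a₁ x)
    (ho : o ∈ V₁) (hb : b ∈ V₁)
    (hroute : ∀ ω ∈ supp p, ω ∈ avoidAll ends a₂ {a₁} →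
      (ω ∈ connEvent ends a₁ v ↔ ω ∈ allOpen π₁ ∪ allOpen π₂)) :
    0 ≤ crossC p (∏ e ∈ π₁, p e + ∏ e ∈ π₂, p e - (∏ e ∈ π₁, p e) * ∏ e ∈ π₂, p e)
      ends o a₁ a₂ v b := by
  classical
  have hxv := prob_xv_eq_supp p hπ₂ hconn₁ hconn₂ ho hroute
  have hyv := prob_xv_eq_supp p hπ₂ hconn₁ hconn₂ hb hroute
  have hDv := prob_Dv_eq_supp_same p b hπ₂ hconn₁ hconn₂ ho hroute
  have hPHI := avoid_crux_nonneg p hp ends o a₁ a₂ b V₂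
  have hp₁0 : 0 ≤ ∏ e ∈ π₁, p e := Finset.prod_nonneg fun e _ => hp.nonneg e
  have hp₂0 : 0 ≤ ∏ e ∈ π₂, p e := Finset.prod_nonneg fun e _ => hp.nonneg e
  have hp₂1 : ∏ e ∈ π₂, p e ≤ 1 :=
    Finset.prod_le_one (fun e _ => hp.nonneg e) (fun e _ => hp.le_one e)
  have hx0 : 0 ≤ prob p (avoidAll ends a₂ {a₁} ∩ connEvent ends a₂ o) := prob_nonneg hp _
  have hy0 : 0 ≤ prob p (avoidAll ends a₂ {a₁} ∩ connEvent ends a₂ b) := prob_nonneg hp _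
  unfold crossC
  rw [hDv, hxv, hyv]
  have k := mul_nonneg (mul_nonneg hp₁0 (sub_nonneg.2 hp₂1)) (mul_nonneg hx0 hy0)
  nlinarith [mul_nonneg hp₂0 hPHI, k]

end CrossAPrimeTwoRoutesSameSupp

end Summit.Ventures.PercRepro2
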